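import Summits.Ventures.DiscreteObjects.PP12.FanoFiveOrbitMatrix

/-!
# PP(12), order 5: the orbit matrix WITH the incidence of the fixed Fano subplane (typed finite statement, plain matrix form + incidence)
Framing: lottery ticket; floor = certified bounds/negative ranges.

Cell pub-namedobj (venture DiscreteObjects), target (M), designs gen 15. `IsFanoFiveOrbitMatrix` (`FanoFiveOrbitMatrix`, p350564) is the plain
`30 × 30` system (totals and inner products). It forgets HOW the fixed Fano subplane sits in the matrix: tangent rows `(x, a)` are the two orbits
of non-fixed lines through the fixed point `x`, tangent columns `(μ, b)` the two orbits of non-fixed points on the fixed line `μ`, and a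
non-fixed line through `x` meets `μ` in a non-fixed point iff `x ∉ μ` (if `x ∈ μ` the intersection is `x` itself). So with the incidence
`I x μ :⇔ x ∈ μ` of the fixed subplane — a labelled Fano plane, `FanoFive.IsIncidence I` — the tangent blocks satisfy
`Σ_b M (x,a) (μ,b) = [x ∉ μ]`, `Σ_a M (x,a) (μ,b) = [x ∉ μ]`, and an exterior line (point) meets every fixed line (is joined to every fixed point)
in exactly one tangent point (by exactly one tangent line): `Σ_b M e (μ,b) = 1`, `Σ_a M (x,a) e = 1`. `IsFanoFiveIncMatrix I M` adds these
four block systems to the plain one; `NoFanoFiveIncMatrix` quantifies over all labelled Fano incidences `I` (an engine fixes one: all are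
isomorphic, `30` labellings each of `PG(2,2)`); `FanoFiveIncReduction` (plane ⇒ `∃ I M`) is typed here and proved in `FanoFiveIncReduction`
(designs g15). This is the structure designs g10's engines used (there: signs `ε`, `m(x, μ)`); their EMPTY verdict is a computation outside the
kernel and is NOT asserted here. No `sorry`, no new axioms.
-/

namespace Summit.Ventures.DiscreteObjects.PP12

open Finset

namespace FanoFive

/-- A labelled Fano plane on `Fin 7` (points) `× Fin 7` (lines): every point on `3` lines, every line through `3` points, two distinct points
on exactly one common line. -/
def IsIncidence (I : Fin 7 → Fin 7 → Bool) : Prop :=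
  (∀ x : Fin 7, (univ.filter fun μ : Fin 7 => I x μ = true).card = 3) ∧
  (∀ μ : Fin 7, (univ.filter fun x : Fin 7 => I x μ = true).card = 3) ∧
  (∀ x x' : Fin 7, x ≠ x' → (univ.filter fun μ : Fin 7 => I x μ = true ∧ I x' μ = true).card = 1)

end FanoFive

/-- **Orbit matrix of an order-5 collineation of PP(12) together with the incidence `I` of its fixed Fano subplane**: the plain system plus the
four tangent-block systems. -/
def IsFanoFiveIncMatrix (I : Fin 7 → Fin 7 → Bool) (M : F5Idx → F5Idx → ℕ) : Prop :=
  IsFanoFiveOrbitMatrix M ∧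
  (∀ (x : Fin 7) (a : Fin 2) (μ : Fin 7), ∑ b : Fin 2, M (Sum.inl (x, a)) (Sum.inl (μ, b)) = if I x μ then 0 else 1) ∧
  (∀ (e : Fin 16) (μ : Fin 7), ∑ b : Fin 2, M (Sum.inr e) (Sum.inl (μ, b)) = 1) ∧
  (∀ (μ : Fin 7) (b : Fin 2) (x : Fin 7), ∑ a : Fin 2, M (Sum.inl (x, a)) (Sum.inl (μ, b)) = if I x μ then 0 else 1) ∧
  (∀ (e : Fin 16) (x : Fin 7), ∑ a : Fin 2, M (Sum.inl (x, a)) (Sum.inr e) = 1)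

/-- **Census statement at the orbit level with incidence (typed; decided EMPTY only outside the kernel, designs g10):** no labelled Fano incidence
admits an orbit matrix. -/
def NoFanoFiveIncMatrix : Prop :=
  ∀ (I : Fin 7 → Fin 7 → Bool) (M : F5Idx → F5Idx → ℕ), FanoFive.IsIncidence I → ¬ IsFanoFiveIncMatrix I M

/-- **The orbit-matrix reduction of the order-5 cell, with incidence** (typed; proved in `FanoFiveIncReduction`). -/
def FanoFiveIncReduction : Prop :=
  ∀ (P L : Type) [Membership P L] [Fintype P] [Fintype L] [Configuration.ProjectivePlane P L],
    Configuration.ProjectivePlane.order P L = 12 → ∀ σ : Collineation P L, σ.onPoints ^ 5 = 1 → σ.onPoints ≠ 1 →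
      ∃ (I : Fin 7 → Fin 7 → Bool) (M : F5Idx → F5Idx → ℕ), FanoFive.IsIncidence I ∧ IsFanoFiveIncMatrix I M

/-- **How the census uses it:** reduction + emptiness of the orbit level (with incidence) close the order-5 cell. Pure logic. -/
theorem noOrderFive_of_fanoFiveIncReduction (hred : FanoFiveIncReduction) (hno : NoFanoFiveIncMatrix) : NoOrderFiveOrder12 := by
  intro P L _ _ _ _ h12 σ hq
  by_contra hne
  obtain ⟨I, M, hI, hM⟩ := hred P L h12 σ hq hne
  exact hno I M hI hM

/-- The plain statement implies the one with incidence (the latter has more equations, hence fewer solutions to exclude). -/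
theorem noFanoFiveIncMatrix_of_noFanoFiveOrbitMatrix (hno : NoFanoFiveOrbitMatrix) : NoFanoFiveIncMatrix :=
  fun _ M _ hM => hno M hM.1

/-- The reduction with incidence implies the plain reduction. -/
theorem fanoFiveReduction_of_inc (hred : FanoFiveIncReduction) : FanoFiveReduction := by
  intro P L _ _ _ _ h12 σ hq hne
  obtain ⟨_, M, -, hM⟩ := hred P L h12 σ hq hne
  exact ⟨M, hM.1⟩

namespace IsFanoFiveIncMatrix

variable {I : Fin 7 → Fin 7 → Bool} {M : F5Idx → F5Idx → ℕ}

/-- Sanity of the encoding: a tangent row has exactly `4` ones in the tangent columns (one on each fixed line not through its fixed point) … -/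
theorem tangent_row_tangent_sum (hI : FanoFive.IsIncidence I) (h : IsFanoFiveIncMatrix I M) (x : Fin 7) (a : Fin 2) :
    ∑ μ : Fin 7, ∑ b : Fin 2, M (Sum.inl (x, a)) (Sum.inl (μ, b)) = 4 := by
  simp_rw [h.2.1 x a]
  rw [Finset.sum_ite, Finset.sum_const_zero, zero_add, Finset.sum_const, smul_eq_mul, mul_one]
  have h3 := hI.1 x
  have htot : (univ.filter fun μ : Fin 7 => I x μ = true).card + (univ.filter fun μ : Fin 7 => ¬ I x μ = true).card = 7 := by
    rw [Finset.card_filter_add_card_filter_not]; simp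
  have : (univ.filter fun μ : Fin 7 => ¬ I x μ = true) = univ.filter fun μ : Fin 7 => ¬ I x μ := by simp
  omega

/-- … and hence `8` points in the exterior columns (`12 − 4`). -/
theorem tangent_row_exterior_sum (hI : FanoFive.IsIncidence I) (h : IsFanoFiveIncMatrix I M) (x : Fin 7) (a : Fin 2) :
    ∑ e : Fin 16, M (Sum.inl (x, a)) (Sum.inr e) = 8 := by
  have htot := h.1.1 (Sum.inl (x, a))
  rw [Fintype.sum_sum_type, Fintype.sum_prod_type] at htot
  have h4 := tangent_row_tangent_sum hI h x a
  simp only [FanoFive.total] at htot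
  omega

/-- An exterior row has `7` points in the tangent columns (one on each fixed line) and `6` in the exterior columns. -/
theorem exterior_row_exterior_sum (h : IsFanoFiveIncMatrix I M) (e : Fin 16) :
    ∑ e' : Fin 16, M (Sum.inr e) (Sum.inr e') = 6 := by
  have htot := h.1.1 (Sum.inr e)
  rw [Fintype.sum_sum_type, Fintype.sum_prod_type] at htot
  simp_rw [h.2.2.1 e] at htot
  simp only [FanoFive.total, sum_const, card_univ, Fintype.card_fin, smul_eq_mul, mul_one] at htot
  omega

end IsFanoFiveIncMatrix

end Summit.Ventures.DiscreteObjects.PP12
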